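import Summits.QuantumFields.YangMills.Theorems.BalabanUVNodesN12MinimiserFamilyOfClassNearFlatCoercive
import Summits.QuantumFields.YangMills.Theorems.BalabanUVNodesN12FlatAveragedCoerciveOfForestSU2Chart
import Literature.MathematicalPhysics.QuantumFieldTheory.Balaban1983to89.B15Prop1FlatAverageBoundOfGuardOn

/-!
# DAG node N12 [B15] — THE (J0′) PRODUCER OF RECORD WITH THE (β) ROW's ANALYTIC LETTERS ALL DISCHARGED PER INSTANCE: per base field only GAUGE rows ((δ) on `Ω₁(Z)`, (δ_T) on the
# constraint towers), the multiplier letter (M) (dag-n12-w6) and Theorem-1 rows remain; the flat coercivity (P) = (P♭Q) + (L) is a THEOREM (constants existential, announced per instance)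

[Balaban1989LargeFieldII] = «[LF-II]», p. 357, (1.7)–(1.9) p. 358, (1.12) p. 359; [Balaban1989LargeFieldI] = «[IV]», (1.74) p. 192, Prop. 1 p. 194; [Balaban1985Variational] = «[15]», Thm 1
p. 279, Sect. C (44)–(48) p. 285, (82)–(83) p. 290, Sect. G pp. 305–307; [Balaban1984PropagatorsII] = «[B6]», Lemma 2.4 (2.128) p. 245; [Balaban1985Averaging] = «[4]», (122)–(126) p. 36;
[Balaban1985BackgroundPropagators] = «[B9]», (3.79)–(3.81) p. 406; [Balaban1988Convergent] = «[III]», (2.2) p. 255, (2.10)–(2.13) pp. 256–257.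

Cell `pub-ymgap`, HUMAN RULINGS D-0062 ∕ D-0149, lane owner `pub-ymgap-dag-n12-c` (g25, strategy s1).  Key K1⁹ `stmt-QuantumFields-27364`, `--kind proof --supports … --as helper`; count-neutral.
NEW leaf; CONSUMED BY NAME, nothing modified: the lane's (β)-split capstone edition `…N12MinimiserFamilyOfClassNearFlatCoercive` (p712371), the (P♭Q) inhabitant in the split's currency
`…N12FlatAveragedCoerciveOfForestSU2Chart` (g25; compactness over dag-n12-w3's flat (β)♭), the (L) inhabitant `B15Prop1FlatAverageBoundOfGuardOn` (g25; tower calculus), the split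
`B15Prop1FlatCoerciveSplit` (p711994), the minimiser's tower guards from its class `…N12TowerGuardsOfClass` (g24).

WHY (lane memo `N12-UNIFORMITY-SPEC.md` §8).  p712371 displays per base field the flat coercivity letter (P) of the (β) split.  (P) ⟸ (P♭Q) + (L) (p711994 §1); (P♭Q) holds per instance
for the forest slice of `𝐁_k(Z)` with an existential constant `c♭` (compactness); (L) holds per instance with `CL = #constr·C²·δT²` at every base field carrying the (J0′) producer's tower
guards (here: read off the class) and `δT`-flat on its positive-level towers (a gauge row of the same species as (δ)).  THIS FILE assembles: the forest and slice become INSTANCE-LEVEL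
inputs ((F1), (F2), (TREE), (F3) — dag-n12-w3's `exists_forest_slice_Bj` supplies all four at once), the constants `c♭, C, r` are ANNOUNCED (∃) before the tolerances, and per base field
the (P) row is GONE.

CONTENTS (namespace `Summit.QuantumFields.YangMills.BalabanUVNodes.N12MinimiserFamilyOfClassGaugeRows`; one theorem, no `def`, no `instance`, no `sorry`).
★★★ `hMin_atRecord_of_node00Letters_thm1AtBase_central_ofClass_gaugeRows` — `∃ c♭ > 0, C ≥ 0, r > 0` (depending on the instance `(Kt, k, Z, ν.M₁, forest)` only) such that for all
tolerances `δc, δT ≥ 0`, `δT ≤ r`, and multiplier constant `m` with `64(d−1)δc + m + #constr·C²·δT² < c♭`, the per-base-field rows (E) · datum regularity on `Z` · `a` · `Φ₀` · (45)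
velocity · (δ) · (δ_T) · (M) · (T1@q₀) give the (J0′) conclusion `∃ R > 0, ∀ V_k ∈ K, …` VERBATIM.

HONEST FRAMING ∕ LOCATED.  Composition by name; (δ), (δ_T) are GAUGE letters (bondwise near-flatness: at a (2.12)-minimiser they hold after a gauge normalisation of the window — the direct
road's (N) producers, LOCATED-GEOM v3 for the shape coverage), (M) is dag-n12-w6's letter; the constants `c♭, C, r` are EXISTENTIAL per instance (U4 grade; k-uniformity NOT claimed —
print's constants are [B6] (2.128)'s `(12d²)⁻¹L^{−d−1}` and [4] (124)–(126)'s `O(L²α₀)`); nothing of Bałaban's estimates asserted; count-neutral helper; N12 NOT discharged; K1⁹ NOT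
closed; counts unmoved; one finite 𝕋⁴ programme at fixed ε — R4 closes the conditional finite-𝕋⁴ rung `BalabanLadder.UV` only; NOT continuum ∕ OS ∕ mass gap ∕ Clay.
-/

noncomputable section

open scoped BigOperators Matrix.Norms.L2Operator Topology

namespace Summit.QuantumFields.YangMills.BalabanUVNodes.N12MinimiserFamilyOfClassGaugeRows

open Set Metric Filter
open Literature.MathematicalPhysics.QuantumFieldTheory.Balaban1983to89
open Literature.MathematicalPhysics.QuantumFieldTheory.Balaban1983to89.Node00 (SU coeField coeField_apply SmallBelow ConstrSet constrCard constrEnum dIterL)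
open T4Continuum B15DeterminingSets GaugeField
open B14.Eq213MaximalDomains (side)
open B14.Eq213DetSet (Bj Bj_of_gt Bj_zero maxDomT)
open B15Prop1Carrier (plaqsInside)
open B15AveragingHolomorphic (iterMh)
open B15ComplexifiedDatumFamily (conjVec)
open B15SU2ChartHolomorphic (genE expMulC logCoordC)
open B15Prop1AnalyticExtClause (cplxVec norm_cplxVec_apply)
open B15Prop1ChartCalculusSU2 (E3)
open B15Prop1ChartSU2 (su2Chart)
open B15ShellGauge193 (shellGauge)
open B15Extension193 (extend)
open B16Sect1Backgrounds (toMS expMul)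
open ExpMeanLog (expMeanLogSU)
open BlockAveraging (blockAvg)
open T4CubeChartGnomonic (SU2)
open Literature.MathematicalPhysics.QuantumFieldTheory.BalabanImbrieJaffe1984to88.BIJ85Eq453GaugeField (qsstarGIter0)
open B15Prop1FlatCoerciveSplit (flatCoercive_of_flatAveragedCoercive_of_flatAverageBound_sliceDatum)
open B15Prop1FlatAverageBoundOfGuardOn (exists_flatAverageBound_of_guardOn_towerNearFlat)
open Summit.QuantumFields.YangMills.BalabanUVNodes.N12TowerGuardsOfClass (guardOn_towerRegion_Bj_of_mem_class)
open Summit.QuantumFields.YangMills.BalabanUVNodes.N12MinimiserFamilyOfClassNearFlatCoercive (hMin_atRecord_of_node00Letters_thm1AtBase_central_ofClass_nearFlat)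
open Summit.QuantumFields.YangMills.BalabanUVNodes.N12FlatAveragedCoerciveOfForestSU2Chart (exists_flatAveragedCoercive_forest_Bj_su2Chart)
open scoped Matrix.Norms.L2Operator

variable {F : T4Family} {k : ℕ}

/-- ★★★ **THE (J0′) PRODUCER AT N12's RECORD WITH THE (β) ROW REDUCED TO GAUGE ROWS, THE MULTIPLIER LETTER AND NUMERICS.**  Instance-level: the capstone's record data (`𝔹 = 𝐁_k(Z)`, class,
radius letter, floors, class facts) + ONE forest with its axial slice ((F1), (F2), (TREE), (F3) — dag-n12-w3's `exists_forest_slice_Bj`).  ANNOUNCED (∃, per instance): the flat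
coercivity `c♭ > 0` of (P♭Q) for this forest slice, the (L) constant `C ≥ 0` and radius `r > 0`.  THEN for all tolerances `0 ≤ δc`, `0 ≤ δT ≤ r` and multiplier constant `m` with
`64(d−1)δc + m + #constr·C²·δT² < c♭`, and per base field `V_k ∈ K`: (E) the minimiser `U₀`, the datum's regularity on `Z`, the slice action `a` and datum coordinates `Φ₀` (pointwise),
(45) velocity, (δ) `U₀` `δc`-flat on the plaquettes meeting a bond sourced in `Ω₁(Z)`, (δ_T) `U₀` `δT`-flat on the level-0 bonds of the towers of the positive-level constrained bonds,
(M) the multiplier letter with constant `m`, (T1@q₀) — the conclusion `∃ R > 0, ∀ V_k ∈ K, ∃ Ũ holomorphic bounded on the polydisc with (2.12)-minimiser real points`.  Proof: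
p712371 at `cP := c♭ − #constr·C²·δT²` with its (P) row supplied by `B15Prop1FlatCoerciveSplit` §1 from (P♭Q) (`…FlatAveragedCoerciveOfForestSU2Chart`) and (L)
(`B15Prop1FlatAverageBoundOfGuardOn`, fed the minimiser's tower guards read off its class).
[cite: Balaban1989LargeFieldII, p.357, (1.7)–(1.9) p.358, (1.12) p.359; Balaban1989LargeFieldI, (1.74) p.192, Prop. 1 p.194; Balaban1985Variational, Thm 1 p.279, Sect. C (44)–(48) p.285, (82)–(83) p.290, Sect. G pp.305–307; Balaban1984PropagatorsII, Lemma 2.4 (2.128) p.245; Balaban1985Averaging, (122)–(126) p.36; Balaban1985BackgroundPropagators, (3.79)–(3.81) p.406; Balaban1988Convergent, (2.2) p.255, (2.10)–(2.13) pp.256–257] -/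
theorem hMin_atRecord_of_node00Letters_thm1AtBase_central_ofClass_gaugeRows (ν : Node00.Stage7Numerics) (Kt : ℕ) (hd : 2 ≤ (F.P Kt).d) (Z : Set (Site (F.P Kt) 0))
    (Λ : Set (Site (F.P Kt) k)) (lo hi : Fin (F.P Kt).d → ℤ) (𝔹 : DetSet (F.P Kt)) (h𝔹Z : 𝔹 = Bj ν.M₁ Z k) (hkK : k + 1 ≤ (F.P Kt).m + (F.P Kt).K)
    (hM4 : 4 * (F.P Kt).L ≤ ν.M₁) (hdiv : side (F.P Kt).L ν.M₁ k ∣ (F.P Kt).sitesPerDir 0) (hZblk : B14.Eq22Determines.IsBlockUnion k Z) (hε : 0 ≤ ν.εreg)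
    {ρ'' : ℝ} (hsbU : ∀ W : GaugeField (F.P Kt) 0 SU2, ‖coeField W - 1‖ ≤ ρ'' → SmallBelow (Node00.avOfRecord F 2 Kt) k W)
    (hερ : 6 * ((((F.P Kt).d - 1 : ℕ)) : ℝ) * (F.P Kt).L * ν.εreg ≤ ρ'') {δ : ℝ} (hδ : 0 < δ) (hδρ : 6 * ((((F.P Kt).d - 1 : ℕ)) : ℝ) * (F.P Kt).L ^ k * δ ≤ ρ'')
    (ext : GaugeField (F.P Kt) k SU2 → GaugeField (F.P Kt) k SU2) (hext : ∀ W, ext W = extend Λ (shellGauge W lo hi) W)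
    {K : Set (GaugeField (F.P Kt) k SU2)} (hK : IsCompact K) {𝓐₀ : ℝ} (h𝓐₀ : 1 < 𝓐₀)
    (reg' : Set (GaugeField (F.P Kt) 0 SU2)) (hreg' : IsClosed reg') (hcl : closure (Node00.regMSCoPOfRecord F 2 ν Kt k (maxDomT ν.M₁ Z)) ⊆ reg')
    (hDreg' : ContinuousOn (fun (U : GaugeField (F.P Kt) 0 SU2) (i : Fin (constrCard 𝔹 k)) =>
      ((avgFamily (Node00.avOfRecord F 2 Kt) U ((constrEnum 𝔹 k).symm i).1 ((constrEnum 𝔹 k).symm i).2.1 : SU2) : Matrix (Fin 2) (Fin 2) ℂ)) reg')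
    -- ONCE per height: the numerics of the (β) split — the near-flat tolerance, the flat coercivity constant, the multiplier constant
    (hk0 : 0 < k)
    -- ONE forest and its axial slice per instance (dag-n12-w3's `N12ForestSlice.exists_forest_slice_Bj`): (F1), (F2), (TREE), (F3)
    (path : Site (F.P Kt) 0 → List (LStep (F.P Kt) 0)) (S : Submodule ℂ (VecField (F.P Kt) 0 (EuclideanSpace ℂ (Fin 3))))
    (hF1 : ∀ x, ∀ s ∈ path x, ∃ x' x'' : Site (F.P Kt) 0, path x'' = path x' ++ [s] ∧
        (s.fwd = true → s.bond.src = x' ∧ s.bond.tgt = x'') ∧ (s.fwd = false → s.bond.src = x'' ∧ s.bond.tgt = x'))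
    (hF2 : ∀ j, j ≤ k → ∀ c ∈ bondsOf (𝔹 j), path (embIter j c.src) = [] ∧ path (embIter j c.tgt) = [])
    (hTREE : ∀ x : Site (F.P Kt) 0, x ∉ {z : Site (F.P Kt) 0 | ∃ j, j ≤ k ∧ ∃ c ∈ bondsOf (𝔹 j), (z = embIter j c.src ∨ z = embIter j c.tgt)} →
      ∃ (x' : Site (F.P Kt) 0) (s : LStep (F.P Kt) 0), path x = path x' ++ [s] ∧
        (s.fwd = true → s.bond.src = x' ∧ s.bond.tgt = x) ∧ (s.fwd = false → s.bond.src = x ∧ s.bond.tgt = x'))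
    (hF3 : ∀ X : VecField (F.P Kt) 0 (EuclideanSpace ℂ (Fin 3)), X ∈ S ↔ ∀ x, ∀ s ∈ path x, X s.bond = 0) :
    -- THE CONSTANTS OF THE (β) ROW, announced before the tolerances and the base fields: the flat coercivity `c♭` of (P♭Q), the (L) constant `C` and radii `r_i`
    ∃ cflat C r : ℝ, 0 < cflat ∧ 0 ≤ C ∧ 0 < r ∧
    ∀ {δc δT m : ℝ}, 0 ≤ δc → 0 ≤ δT → δT ≤ r →
      64 * (((F.P Kt).d : ℝ) - 1) * δc + m + (constrCard 𝔹 k : ℝ) * C ^ 2 * δT ^ 2 < cflat →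
    (∀ Vk ∈ K, ∃ (U₀ : GaugeField (F.P Kt) 0 SU2) (a : S → ℂ) (Φ₀ : S → Fin (constrCard 𝔹 k) → EuclideanSpace ℂ (Fin 3)),
      IsMinimizer (Node00.avOfRecord F 2 Kt) (Node00.regMSCoPOfRecord F 2 ν Kt k (maxDomT ν.M₁ Z)) 𝔹
        (avgFamily (Node00.avOfRecord F 2 Kt) (qsstarGIter0 k (ext Vk))) U₀ ∧
      PlaqSmallOn (plaqsInside (pts k Z)) δ (ext Vk) ∧
      (∀ X : S, a X = ∑ p : Plaq (F.P Kt) 0, (1 - (expMulC (X : VecField (F.P Kt) 0 (EuclideanSpace ℂ (Fin 3))) (coeField U₀) ⟨p.src, p.μ⟩ *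
        expMulC (X : VecField (F.P Kt) 0 (EuclideanSpace ℂ (Fin 3))) (coeField U₀) ⟨p.src.shift p.μ, p.ν⟩ *
        Matrix.adjugate (expMulC (X : VecField (F.P Kt) 0 (EuclideanSpace ℂ (Fin 3))) (coeField U₀) ⟨p.src.shift p.ν, p.μ⟩) *
        Matrix.adjugate (expMulC (X : VecField (F.P Kt) 0 (EuclideanSpace ℂ (Fin 3))) (coeField U₀) ⟨p.src, p.ν⟩)).trace / 2)) ∧
      (∀ (X : S) i, Φ₀ X i = logCoordC (star ((avgFamily (Node00.avOfRecord F 2 Kt) (qsstarGIter0 k (ext Vk))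
        ((constrEnum 𝔹 k).symm i).1 ((constrEnum 𝔹 k).symm i).2.1 : SU2) : Matrix (Fin 2) (Fin 2) ℂ) *
        iterMh ((constrEnum 𝔹 k).symm i).1 (expMulC (X : VecField (F.P Kt) 0 (EuclideanSpace ℂ (Fin 3))) (coeField U₀)) ((constrEnum 𝔹 k).symm i).2.1)) ∧
      -- (45), VELOCITY currency — the capstone's row verbatim
      (∀ τ : Fin (constrCard 𝔹 k) → EuclideanSpace ℝ (Fin 3), ∃ p : VecField (F.P Kt) 0 E3, cplxVec p ∈ S ∧
        ∀ i : Fin (constrCard 𝔹 k), HasDerivAt (fun s : ℝ => ((avgFamily (Node00.avOfRecord F 2 Kt) (expMul su2Chart (s • p) U₀)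
          ((constrEnum 𝔹 k).symm i).1 ((constrEnum 𝔹 k).symm i).2.1 : SU2) : Matrix (Fin 2) (Fin 2) ℂ))
          (((avgFamily (Node00.avOfRecord F 2 Kt) (qsstarGIter0 k (ext Vk)) ((constrEnum 𝔹 k).symm i).1
            ((constrEnum 𝔹 k).symm i).2.1 : SU2) : Matrix (Fin 2) (Fin 2) ℂ) * ∑ b : Fin 3, ((τ i b : ℝ) : ℂ) • genE b) 0) ∧
      -- (δ) DISPLAYED (GAUGE letter, the direct road's (N)-package clause): `U₀` bondwise `δc`-flat on the plaquettes meeting a bond sourced in `Ω₁(Z)`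
      (∀ q : Plaq (F.P Kt) 0, ((⟨q.src, q.μ⟩ : PBond (F.P Kt) 0) ∈ {b : PBond (F.P Kt) 0 | b.src ∈ maxDomT ν.M₁ Z 1} ∨
          (⟨q.src.shift q.μ, q.ν⟩ : PBond (F.P Kt) 0) ∈ {b : PBond (F.P Kt) 0 | b.src ∈ maxDomT ν.M₁ Z 1} ∨
          (⟨q.src.shift q.ν, q.μ⟩ : PBond (F.P Kt) 0) ∈ {b : PBond (F.P Kt) 0 | b.src ∈ maxDomT ν.M₁ Z 1} ∨
          (⟨q.src, q.ν⟩ : PBond (F.P Kt) 0) ∈ {b : PBond (F.P Kt) 0 | b.src ∈ maxDomT ν.M₁ Z 1}) →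
        ‖((U₀ ⟨q.src, q.μ⟩ : SU2) : Matrix (Fin 2) (Fin 2) ℂ) - 1‖ ≤ δc ∧ ‖((U₀ ⟨q.src.shift q.μ, q.ν⟩ : SU2) : Matrix (Fin 2) (Fin 2) ℂ) - 1‖ ≤ δc ∧
          ‖((U₀ ⟨q.src.shift q.ν, q.μ⟩ : SU2) : Matrix (Fin 2) (Fin 2) ℂ) - 1‖ ≤ δc ∧ ‖((U₀ ⟨q.src, q.ν⟩ : SU2) : Matrix (Fin 2) (Fin 2) ℂ) - 1‖ ≤ δc) ∧
      -- (δ_T) DISPLAYED (GAUGE letter): `U₀` bondwise `δT`-flat on the level-0 bonds of the tower regions of the POSITIVE-LEVEL constrained bonds of `𝐁_k(Z)`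
      (∀ i : Fin (constrCard 𝔹 k), 0 < (((constrEnum 𝔹 k).symm i).1 : ℕ) →
        ∀ b : PBond (F.P Kt) 0, b ∈ B10Eq42TorusConstraint.bondsIn 0 (B14.Eq22Determines.blockIter (((constrEnum 𝔹 k).symm i).1 : ℕ) ⁻¹'
          ({((constrEnum 𝔹 k).symm i).2.1.src, ((constrEnum 𝔹 k).symm i).2.1.tgt} : Set (Site (F.P Kt) ((constrEnum 𝔹 k).symm i).1))) →
          ‖((U₀ b : SU2) : Matrix (Fin 2) (Fin 2) ℂ) - 1‖ ≤ δT) ∧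
      -- (M) DISPLAYED: the MULTIPLIER letter, for every multiplier of the base state
      (∀ ℓ₀ : (Fin (constrCard 𝔹 k) → EuclideanSpace ℂ (Fin 3)) →L[ℂ] ℂ, fderiv ℂ a 0 = ℓ₀.comp (fderiv ℂ Φ₀ 0) →
        ∀ (p : VecField (F.P Kt) 0 E3) (hp : cplxVec p ∈ S), fderiv ℂ Φ₀ 0 ⟨cplxVec p, hp⟩ = 0 →
          (ℓ₀ (fderiv ℂ (fderiv ℂ Φ₀) 0 ⟨cplxVec p, hp⟩ ⟨cplxVec p, hp⟩)).re ≤ m * ∑ b : PBond (F.P Kt) 0, ‖p b‖ ^ 2) ∧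
      -- (T1@q₀) — the capstone's row verbatim
      (∀ U ∈ reg', AgreeOn 𝔹 (avgFamily (Node00.avOfRecord F 2 Kt) U) (avgFamily (Node00.avOfRecord F 2 Kt) (qsstarGIter0 k (ext Vk))) →
        wilsonAction4 U ≤ wilsonAction4 U₀ →
          ∃ u : GaugeTransf (F.P Kt) 0 SU2, (∀ j, j ≤ k → ∀ b ∈ bondsOf (𝔹 j), toMS u j b.src = toMS u j b.tgt ∧ ∀ g : SU2, toMS u j b.src * g = g * toMS u j b.src) ∧ gaugeAct u U = U₀)) →
    ∃ R : ℝ, 0 < R ∧ ∀ Vk ∈ K,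
      ∃ Ũ : VecField (F.P Kt) k (EuclideanSpace ℂ (Fin 3)) × VecField (F.P Kt) k (EuclideanSpace ℂ (Fin 3)) → PBond (F.P Kt) 0 → Matrix (Fin 2) (Fin 2) ℂ,
        (∀ b i j, DifferentiableOn ℂ (fun z => Ũ z b i j) (ball 0 R)) ∧
        (∀ z ∈ ball (0 : VecField (F.P Kt) k (EuclideanSpace ℂ (Fin 3)) × VecField (F.P Kt) k (EuclideanSpace ℂ (Fin 3))) R, ∀ b i j, ‖Ũ z b i j‖ ≤ 𝓐₀) ∧
        ∀ p B' : VecField (F.P Kt) k E3, ‖p‖ < R → ‖B'‖ < R → ∃ U' : GaugeField (F.P Kt) 0 SU2,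
          (∀ b, Ũ (cplxVec p, cplxVec B') b = ((U' b : SU2) : Matrix (Fin 2) (Fin 2) ℂ)) ∧
            IsMinimizer (Node00.avOfRecord F 2 Kt) (Node00.regMSCoPOfRecord F 2 ν Kt k (maxDomT ν.M₁ Z)) 𝔹
              (avgFamily (Node00.avOfRecord F 2 Kt) (qsstarGIter0 k (expMul su2Chart B' (ext (expMul su2Chart p Vk))))) U' := by
  subst h𝔹Z
  have hk : k ≤ (F.P Kt).m + (F.P Kt).K := Nat.le_of_succ_le hkK
  have hk1 : 1 ≤ k := hk0
  have hM : 1 ≤ ν.M₁ := le_trans (le_trans (F.P Kt).L_pos (by omega)) hM4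
  -- the constants: `c♭` of (P♭Q) for this forest (compactness, dag-n12-w3's flat (β)♭), `C`, `r_i` of (L) (the tower calculus)
  obtain ⟨cflat, hcflat, hPQ⟩ := exists_flatAveragedCoercive_forest_Bj_su2Chart (F := F) (K := Kt) (Z := Z) hk hk1 hM hdiv hTREE
  obtain ⟨C, r, hC, hr, hL⟩ := exists_flatAverageBound_of_guardOn_towerNearFlat (Bj ν.M₁ Z k) k hk
  refine ⟨cflat, C, r, hcflat, hC, hr, fun {δc δT m} hδc0 hδT0 hδTr hnum hbase => ?_⟩
  -- the (β)-split edition of the capstone at `cP := c♭ − #constr·C²·δT²`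
  refine hMin_atRecord_of_node00Letters_thm1AtBase_central_ofClass_nearFlat ν Kt hd Z Λ lo hi (Bj ν.M₁ Z k) rfl hkK hM4 hdiv hZblk hε hsbU hερ hδ hδρ
    ext hext hK h𝓐₀ reg' hreg' hcl hDreg' hk0 (δc := δc) (cP := cflat - (constrCard (Bj ν.M₁ Z k) k : ℝ) * C ^ 2 * δT ^ 2) (m := m) hδc0 (by linarith)
    fun Vk hVk => ?_
  obtain ⟨U₀, a, Φ₀, hmin, hreg, ha, hΦ₀, hH, hNF, hflatT, hMul, hT1⟩ := hbase Vk hVk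
  -- the (P) row at `cP`, DISCHARGED: (P♭Q) (theorem per instance) + (L) (theorem per instance, from the per-tower guards of the class and the (δ_T) row)
  have hgU := guardOn_towerRegion_Bj_of_mem_class ν Kt Z hkK hM4 hdiv hε hsbU hερ hmin.1
  have hslice : ∀ p : VecField (F.P Kt) 0 E3, cplxVec p ∈ S → ∀ x, ∀ s ∈ path x, p s.bond = 0 := fun p hp x s hs => by
    have h0 : cplxVec p s.bond = 0 := (hF3 (cplxVec p)).1 hp x s hs
    have hn : ‖p s.bond‖ = 0 := by rw [← norm_cplxVec_apply, h0, norm_zero]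
    exact norm_eq_zero.1 hn
  have hP : ∀ (p : VecField (F.P Kt) 0 E3) (hp : cplxVec p ∈ S), fderiv ℂ Φ₀ 0 ⟨cplxVec p, hp⟩ = 0 →
      (cflat - (constrCard (Bj ν.M₁ Z k) k : ℝ) * C ^ 2 * δT ^ 2) * ∑ b : PBond (F.P Kt) 0, ‖p b‖ ^ 2 ≤
        deriv (deriv fun s : ℝ => wilsonAction4 (expMul su2Chart (s • p) (1 : GaugeField (F.P Kt) 0 SU2))) 0 :=
    flatCoercive_of_flatAveragedCoercive_of_flatAverageBound_sliceDatum (Bj ν.M₁ Z k) k S Φ₀ (fun p hp => hPQ p (hslice p hp))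
      (fun p hp hker => hL _ U₀ hgU hmin.2.1 S Φ₀ hΦ₀ hδT0 hδTr hflatT p hp hker)
  exact ⟨U₀, S, path, a, Φ₀, hmin, hreg, hF1, hF2, hF3, ha, hΦ₀, hH, hNF, hP, hMul, hT1⟩

end Summit.QuantumFields.YangMills.BalabanUVNodes.N12MinimiserFamilyOfClassGaugeRows

end
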